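import Literature.Probability.Process.BrownianMotion
import Literature.Probability.Process.KolmogorovChentsovHolder
import HarnessLib

/-!
# Kolmogorov–Chentsov on `ℝ≥0`, Hölder form: discharge of the named facts

Topic `Literature/Probability/Process`. The named facts
`ProbabilityTheory.IsKolmogorovProcess.exists_modification_holderOnWith` and
`ProbabilityTheory.IsAEKolmogorovProcess.exists_modification_holderOnWith` of `BrownianMotion.lean`
(Kallenberg 2002, Thm 3.23; Le Gall 2016, Thm 2.9) are DISCHARGED here: the first is literally
`Literature.Probability.Process.exists_modification_holder_of_isKolmogorovProcess`
(`KolmogorovChentsovHolder.lean`, proved), the second is its conditional `…_holds` of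
`BrownianMotion.lean` fed with the first. (The continuity parts are discharged in
`BrownianMotionProofs.lean`.) Wanted by route item stmt-AtomisticToContinuum-9844
(`OddSectorIrreversibility.KernelConeFacts`: cone bookkeeping of the constructed Langevin kernels).
Nothing new is defined.
-/

open MeasureTheory
open scoped NNReal

namespace ProbabilityTheory

variable {Ω E : Type*} {mΩ : MeasurableSpace Ω} [EMetricSpace E]
  [MeasurableSpace E] {p q : ℝ} {M : ℝ≥0} {P : Measure Ω} {X : ℝ≥0 → Ω → E}

/-- The named fact `IsKolmogorovProcess.exists_modification_holderOnWith` (Kolmogorov–Chentsov on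
`ℝ≥0`, Hölder form: a Kolmogorov process with `q > 1` in a complete metric space has a
modification with measurable marginals, continuous paths, locally `γ`-Hölder for every
`γ < (q-1)/p`) holds: it is
`Literature.Probability.Process.exists_modification_holder_of_isKolmogorovProcess`.
[cite: Legall2016, Thm 2.9] -/
theorem IsKolmogorovProcess.exists_modification_holderOnWith_holds :
    IsKolmogorovProcess.exists_modification_holderOnWith (X := X) (P := P) (p := p) (q := q)
      (M := M) := by
  intro _ _ hX hq
  exact Literature.Probability.Process.exists_modification_holder_of_isKolmogorovProcess hX hq

/-- The named fact `IsAEKolmogorovProcess.exists_modification_holderOnWith` holds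
unconditionally (the conditional discharge `…_holds` of `BrownianMotion.lean` fed with
`IsKolmogorovProcess.exists_modification_holderOnWith_holds`).
[cite: Kallenberg2002, Thm 3.23] -/
theorem IsAEKolmogorovProcess.exists_modification_holderOnWith_holds' :
    IsAEKolmogorovProcess.exists_modification_holderOnWith (X := X) (P := P) (p := p) (q := q)
      (M := M) :=
  IsAEKolmogorovProcess.exists_modification_holderOnWith_holds
    fun _ => IsKolmogorovProcess.exists_modification_holderOnWith_holds

end ProbabilityTheory
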